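import Literature.Analysis.FunctionSpaces.BesselMomentsKernelBounds
import Mathlib.Analysis.Calculus.ParametricIntegral
import HarnessLib

/-!
# The rotated Schläfli kernel is holomorphic off `ℝ` and continuous onto `ℝ ∖ {0}` along verticals

Theorem-only sibling of `BesselMomentsKernel.lean` (third file towards
`Zhou2017_B3G_sumRule_holds`).

* `z ↦ ∫₀^∞ k(w)(w + cz)^{-1/2} dw` is complex-differentiable wherever `Im(cz) ≠ 0`
  (differentiation under the integral sign, `hasDerivAt_integral_of_dominated_loc_of_deriv_le`,
  dominated by `k(w)|Im(cz₀)/2|^{-3/2}‖c‖/2`); so `P` (`c = 2`) and the conjugate kernel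
  (`c = -2`) are holomorphic off the real axis;
* **reflection** `conj P(-conj z) = ∫₀^∞ k(w)(w - 2z)^{-1/2} dw` off `ℝ` (the conjugate of the
  principal branch is the principal branch of the conjugate away from the cut), so
  `F = P · conj P(-conj ·)` and `G_{n,j} = Fⁿ zʲ` are holomorphic on the open half-planes;
* **vertical continuity at the real axis**: for real `y ≠ 0`, `δ ↦ P(y + iδ)` is continuous at
  `δ = 0⁺` (dominated convergence with the majorant `m_{|y|}`; at a point where `w + 2y < 0` the
  principal branch `u ↦ u^{-1/2}` is continuous from the closed upper half-plane, which is the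
  side Lean's `Complex.log` takes on the cut).

## References

* [Zhou2017] Y. Zhou, Hilbert transforms and sum rules of Bessel moments, arXiv:1706.01068, §2–3.
-/

noncomputable section

open MeasureTheory Set Filter
open scoped Topology ComplexConjugate

namespace Literature.Analysis.FunctionSpaces

/-! ### Analyticity in the open half-planes and the conjugate kernel -/

/-- `‖u^{t}‖ ≤ m^{t}` when `0 < m ≤ ‖u‖` and `t ≤ 0`. [folklore] -/
theorem norm_cpow_real_le {u : ℂ} {m : ℝ} (hm : 0 < m) (hu : m ≤ ‖u‖) {t : ℝ} (ht : t ≤ 0) :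
    ‖u ^ (t : ℂ)‖ ≤ m ^ t := by
  rw [Complex.norm_cpow_real]
  exact Real.rpow_le_rpow_of_nonpos hm hu ht

/-- **`z ↦ ∫₀^∞ k(w)(w + cz)^{-1/2} dw` is complex-differentiable wherever `Im(cz) ≠ 0`**
(differentiation under the integral sign, dominated by `k(w) |Im(cz₀)/2|^{-3/2} ‖c‖/2`). [folklore] -/
theorem hasDerivAt_integral_zhouIntegrandC {c z₀ : ℂ} (h : (c * z₀).im ≠ 0) :
    DifferentiableAt ℂ (fun z => ∫ w in Ioi (0 : ℝ), zhouIntegrandC c z w) z₀ := by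
  set s : ℂ := (((-(1 / 2) : ℝ)) : ℂ) with hs
  have hs1 : s - 1 = (((-(3 / 2) : ℝ)) : ℂ) := by
    rw [hs]; push_cast; ring
  set m : ℝ := |(c * z₀).im| / 2 with hm
  have hm0 : 0 < m := by
    have : 0 < |(c * z₀).im| := abs_pos.2 h
    positivity
  have hc : c ≠ 0 := by
    rintro rfl; simp at h
  have hc' : 0 < ‖c‖ := norm_pos_iff.2 hc
  set r : ℝ := m / ‖c‖ with hr
  have hr0 : 0 < r := div_pos hm0 hc'
  -- on the ball, `|Im(cz)| ≥ m`
  have him : ∀ z ∈ Metric.ball z₀ r, m ≤ |(c * z).im| := by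
    intro z hz
    rw [Metric.mem_ball, dist_eq_norm] at hz
    have h1 : |(c * z).im - (c * z₀).im| ≤ ‖c‖ * ‖z - z₀‖ := by
      calc |(c * z).im - (c * z₀).im| = |(c * (z - z₀)).im| := by
            rw [mul_sub, Complex.sub_im]
        _ ≤ ‖c * (z - z₀)‖ := Complex.abs_im_le_norm _
        _ = ‖c‖ * ‖z - z₀‖ := norm_mul _ _
    have h2 : ‖c‖ * ‖z - z₀‖ < m := by
      calc ‖c‖ * ‖z - z₀‖ < ‖c‖ * r := mul_lt_mul_of_pos_left hz hc'
        _ = m := by rw [hr]; field_simp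
    have h3 := abs_sub_abs_le_abs_sub (c * z₀).im (c * z).im
    rw [abs_sub_comm] at h3
    have h4 : |(c * z₀).im| = 2 * m := by rw [hm]; ring
    linarith
  have hnorm : ∀ z ∈ Metric.ball z₀ r, ∀ w : ℝ, m ≤ ‖(w : ℂ) + c * z‖ := by
    intro z hz w
    calc m ≤ |(c * z).im| := him z hz
      _ = |((w : ℂ) + c * z).im| := by simp
      _ ≤ ‖(w : ℂ) + c * z‖ := Complex.abs_im_le_norm _
  have hslit : ∀ z ∈ Metric.ball z₀ r, ∀ w : ℝ, (w : ℂ) + c * z ∈ Complex.slitPlane := by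
    intro z hz w
    rw [Complex.mem_slitPlane_iff]
    right
    have h1 := him z hz
    have h2 : ((w : ℂ) + c * z).im = (c * z).im := by simp
    rw [h2]
    intro h0
    rw [h0, abs_zero] at h1
    linarith
  -- the derivative integrand and its bound
  set F' : ℂ → ℝ → ℂ := fun z w => (zhouWeight w : ℂ) * (s * ((w : ℂ) + c * z) ^ (s - 1) * c)
    with hF'
  set bound : ℝ → ℝ := fun w => zhouWeight w * (1 / 2 * m ^ (-(3 / 2) : ℝ) * ‖c‖) with hbound
  have key := hasDerivAt_integral_of_dominated_loc_of_deriv_le (μ := volume.restrict (Ioi (0 : ℝ)))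
    (F := fun z w => zhouIntegrandC c z w) (F' := F') (x₀ := z₀) (bound := bound)
    (Metric.ball_mem_nhds z₀ hr0)
    (Eventually.of_forall fun z => (measurable_zhouIntegrandC c z).aestronglyMeasurable)
    ?_ ?_ ?_ ?_ ?_
  · exact key.2.differentiableAt
  · -- integrability at `z₀`
    refine Integrable.mono' (integrableOn_zhouWeight.mul_const (m ^ (-(1 / 2) : ℝ)))
      (measurable_zhouIntegrandC c z₀).aestronglyMeasurable ?_
    refine ae_restrict_of_forall_mem measurableSet_Ioi fun w hw => ?_
    have hw' : (0 : ℝ) ≤ w := le_of_lt hw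
    rw [zhouIntegrandC, norm_mul, Complex.norm_real, Real.norm_of_nonneg (zhouWeight_nonneg hw')]
    exact mul_le_mul_of_nonneg_left
      (norm_cpow_real_le hm0 (hnorm z₀ (Metric.mem_ball_self hr0) w) (by norm_num))
      (zhouWeight_nonneg hw')
  · -- measurability of `F' z₀`
    simp only [hF']
    apply Measurable.aestronglyMeasurable
    unfold zhouWeight
    fun_prop
  · -- the bound
    refine ae_restrict_of_forall_mem measurableSet_Ioi fun w hw z hz => ?_
    have hw' : (0 : ℝ) ≤ w := le_of_lt hw
    simp only [hF', hbound]
    rw [norm_mul, Complex.norm_real, Real.norm_of_nonneg (zhouWeight_nonneg hw')]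
    refine mul_le_mul_of_nonneg_left ?_ (zhouWeight_nonneg hw')
    rw [norm_mul, norm_mul, hs1]
    have hsn : ‖s‖ = 1 / 2 := by
      rw [hs, Complex.norm_real, Real.norm_eq_abs, abs_neg, abs_of_pos one_half_pos]
    rw [hsn]
    refine mul_le_mul_of_nonneg_right ?_ (norm_nonneg _)
    exact mul_le_mul_of_nonneg_left (norm_cpow_real_le hm0 (hnorm z hz w) (by norm_num))
      (by norm_num)
  · exact integrableOn_zhouWeight.mul_const _
  · -- pointwise derivative
    refine ae_restrict_of_forall_mem measurableSet_Ioi fun w _ z hz => ?_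
    simp only [hF']
    have h1 : HasDerivAt (fun z : ℂ => (w : ℂ) + c * z) c z := by
      simpa using ((hasDerivAt_id z).const_mul c).const_add (w : ℂ)
    have h2 := (h1.cpow_const (c := s) (hslit z hz w))
    exact h2.const_mul _

/-- `P` is complex-differentiable at every `z` off the real axis. [folklore] -/
theorem differentiableAt_zhouP {z : ℂ} (hz : z.im ≠ 0) : DifferentiableAt ℂ zhouP z := by
  have h : zhouP = fun z => ∫ w in Ioi (0 : ℝ), zhouIntegrandC 2 z w := rfl
  rw [h]
  exact hasDerivAt_integral_zhouIntegrandC (by simpa using hz)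

/-- The conjugate kernel `z ↦ ∫₀^∞ k(w)(w - 2z)^{-1/2} dw` is complex-differentiable off the real
axis. [folklore] -/
theorem differentiableAt_zhouQ {z : ℂ} (hz : z.im ≠ 0) :
    DifferentiableAt ℂ (fun z => ∫ w in Ioi (0 : ℝ), zhouIntegrandC (-2) z w) z :=
  hasDerivAt_integral_zhouIntegrandC (by simpa using hz)

/-- **Reflection**: `conj P(-conj z) = ∫₀^∞ k(w)(w - 2z)^{-1/2} dw` off the real axis (the conjugate
of the principal branch is the principal branch of the conjugate, away from the cut). [folklore] -/
theorem conj_zhouP_neg_conj {z : ℂ} (hz : z.im ≠ 0) :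
    conj (zhouP (-conj z)) = ∫ w in Ioi (0 : ℝ), zhouIntegrandC (-2) z w := by
  rw [zhouP, ← integral_conj]
  refine setIntegral_congr_fun measurableSet_Ioi fun w _ => ?_
  have harg : ((w : ℂ) + 2 * -conj z).arg ≠ Real.pi := by
    rw [Ne, Complex.arg_eq_pi_iff, not_and_or]
    right
    simpa using hz
  simp only [zhouIntegrand, zhouIntegrandC, map_mul, Complex.conj_ofReal]
  congr 1
  rw [← Complex.conj_ofReal (-(1 / 2)), ← Complex.conj_cpow _ _ harg, Complex.conj_ofReal]
  congr 1
  simp only [map_add, map_mul, map_neg, Complex.conj_ofReal, Complex.conj_conj, map_ofNat]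
  ring

/-- On the open upper (or lower) half-plane, `F(z) := P(z) conj P(-conj z)` is the product of two
differentiable parametric integrals. [folklore] -/
theorem differentiableAt_zhouP_mul_conj {z : ℂ} (hz : z.im ≠ 0) :
    DifferentiableAt ℂ (fun z => zhouP z * conj (zhouP (-conj z))) z := by
  have h : (fun z => zhouP z * conj (zhouP (-conj z))) =ᶠ[𝓝 z]
      fun z => zhouP z * ∫ w in Ioi (0 : ℝ), zhouIntegrandC (-2) z w := by
    have hopen : IsOpen {u : ℂ | u.im ≠ 0} := isOpen_ne_fun Complex.continuous_im continuous_const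
    filter_upwards [hopen.mem_nhds hz] with u hu
    rw [conj_zhouP_neg_conj hu]
  refine DifferentiableAt.congr_of_eventuallyEq ?_ h
  exact (differentiableAt_zhouP hz).mul (differentiableAt_zhouQ hz)

/-! ### Continuity up to the real axis along vertical segments -/

/-- The principal branch `u ↦ u^{s}` is continuous at a negative real `u` from within the closed
upper half-plane. [folklore] -/
theorem continuousWithinAt_cpow_const_of_re_neg {u : ℂ} (hu : u.re < 0) (hi : u.im = 0) (s : ℂ) :
    ContinuousWithinAt (fun x : ℂ => x ^ s) {x : ℂ | 0 ≤ x.im} u := by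
  have hu0 : u ≠ 0 := fun h0 => by rw [h0] at hu; simp at hu
  have hlog := Complex.continuousWithinAt_log_of_re_neg_of_im_zero hu hi
  have h1 : ContinuousWithinAt (fun x : ℂ => Complex.exp (Complex.log x * s)) {x : ℂ | 0 ≤ x.im} u :=
    (hlog.mul continuousWithinAt_const).cexp
  refine h1.congr_of_eventuallyEq ?_ (Complex.cpow_def_of_ne_zero hu0 s)
  have hne : ∀ᶠ x in 𝓝[{x : ℂ | 0 ≤ x.im}] u, x ≠ 0 :=
    mem_nhdsWithin_of_mem_nhds (isOpen_ne.mem_nhds hu0)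
  filter_upwards [hne] with x hx
  exact Complex.cpow_def_of_ne_zero hx s

/-- `|w - 2|y|| ≤ ‖w + 2(y + iδ)‖` for `w ≥ 0` and real `y, δ`. [folklore] -/
theorem abs_sub_two_mul_abs_le {w : ℝ} (hw : 0 ≤ w) (y δ : ℝ) :
    |w - 2 * abs y| ≤ ‖(w : ℂ) + 2 * ((y : ℂ) + δ * Complex.I)‖ := by
  have h1 : |w + 2 * y| ≤ ‖(w : ℂ) + 2 * ((y : ℂ) + δ * Complex.I)‖ := by
    have := Complex.abs_re_le_norm ((w : ℂ) + 2 * ((y : ℂ) + δ * Complex.I))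
    simpa using this
  refine le_trans ?_ h1
  rcases le_or_gt 0 y with hy | hy
  · rw [abs_of_nonneg hy]
    rw [abs_le]
    constructor
    · have : -(w + 2 * y) ≤ -|w + 2 * y| := by
        rw [abs_of_nonneg (by linarith)]
      linarith [neg_abs_le (w + 2 * y), le_abs_self (w + 2 * y)]
    · linarith [le_abs_self (w + 2 * y)]
  · rw [abs_of_neg hy]
    ring_nf
    rfl

/-- **Vertical continuity at the real axis**: for real `y ≠ 0`,
`δ ↦ P(y + iδ)` is continuous at `δ = 0` from the right (dominated convergence with the majorant
`m_{|y|}`; at a point `w + 2y < 0` the principal branch is continuous from the upper side). [folklore] -/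
theorem continuousWithinAt_zhouP_vertical {y : ℝ} (hy : y ≠ 0) :
    ContinuousWithinAt (fun δ : ℝ => zhouP ((y : ℂ) + δ * Complex.I)) (Ici 0) 0 := by
  have hρ : 0 < |y| := abs_pos.2 hy
  refine continuousWithinAt_of_dominated (bound := zhouMajorant |y|) ?_ ?_
    (integrableOn_zhouMajorant hρ) ?_
  · exact Eventually.of_forall fun δ =>
      (measurable_zhouIntegrand _).aestronglyMeasurable
  · refine Eventually.of_forall fun δ => ?_
    have h1 : ∀ᵐ w ∂(volume.restrict (Ioi (0 : ℝ))), w ≠ 2 * |y| :=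
      ae_restrict_of_ae (Measure.ae_ne volume _)
    have h2 : ∀ᵐ w ∂(volume.restrict (Ioi (0 : ℝ))), w ∈ Ioi (0 : ℝ) :=
      ae_restrict_mem measurableSet_Ioi
    filter_upwards [h1, h2] with w hw1 hw2
    have hw : (0 : ℝ) ≤ w := le_of_lt hw2
    rw [norm_zhouIntegrand _ hw, zhouMajorant]
    refine mul_le_mul_of_nonneg_left ?_ (zhouWeight_nonneg hw)
    have hpos : 0 < |w - 2 * abs y| := abs_pos.2 (sub_ne_zero.2 hw1)
    exact Real.rpow_le_rpow_of_nonpos hpos (abs_sub_two_mul_abs_le hw y δ) (by norm_num)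
  · have h1 : ∀ᵐ w ∂(volume.restrict (Ioi (0 : ℝ))), w ≠ -(2 * y) :=
      ae_restrict_of_ae (Measure.ae_ne volume _)
    filter_upwards [h1] with w hw1
    simp only [zhouIntegrand]
    refine continuousWithinAt_const.mul ?_
    have hpath : ContinuousWithinAt (fun δ : ℝ => (w : ℂ) + 2 * ((y : ℂ) + δ * Complex.I))
        (Ici 0) 0 := by
      refine Continuous.continuousWithinAt ?_
      fun_prop
    have hmaps : MapsTo (fun δ : ℝ => (w : ℂ) + 2 * ((y : ℂ) + δ * Complex.I)) (Ici 0)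
        {x : ℂ | 0 ≤ x.im} := by
      intro δ hδ
      simp only [mem_setOf_eq]
      simp
      have : (0 : ℝ) ≤ δ := hδ
      linarith
    have h0 : (w : ℂ) + 2 * ((y : ℂ) + (0 : ℝ) * Complex.I) = ((w + 2 * y : ℝ) : ℂ) := by
      push_cast; ring
    rcases lt_or_gt_of_ne (show w + 2 * y ≠ 0 from fun h => hw1 (by linarith)) with hneg | hpos
    · -- negative base: continuity from the upper side
      have hc := continuousWithinAt_cpow_const_of_re_neg (u := ((w + 2 * y : ℝ) : ℂ))
        (by simpa using hneg) (by simp) (((-(1 / 2) : ℝ)) : ℂ)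
      rw [← h0] at hc
      exact ContinuousWithinAt.comp (f := fun δ : ℝ => (w : ℂ) + 2 * ((y : ℂ) + δ * Complex.I))
        hc hpath hmaps
    · -- positive base: the principal branch is continuous there
      have hc : ContinuousAt (fun x : ℂ => x ^ (((-(1 / 2) : ℝ)) : ℂ))
          ((w : ℂ) + 2 * ((y : ℂ) + (0 : ℝ) * Complex.I)) := by
        rw [h0]
        exact continuousAt_cpow_const (Complex.ofReal_mem_slitPlane.2 hpos)
      exact ContinuousAt.comp_continuousWithinAt
        (f := fun δ : ℝ => (w : ℂ) + 2 * ((y : ℂ) + δ * Complex.I)) hc hpath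


/-- `F` is complex-differentiable off the real axis. [folklore] -/
theorem differentiableAt_zhouF {z : ℂ} (hz : z.im ≠ 0) : DifferentiableAt ℂ zhouF z :=
  differentiableAt_zhouP_mul_conj hz


/-- `G_{n,j}` is complex-differentiable off the real axis. [folklore] -/
theorem differentiableAt_zhouG (n j : ℕ) {z : ℂ} (hz : z.im ≠ 0) :
    DifferentiableAt ℂ (zhouG n j) z :=
  ((differentiableAt_zhouF hz).pow n).mul (differentiableAt_pow j)


end Literature.Analysis.FunctionSpaces
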